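import Summits.Ventures.PercRepro.MSTightTwoFamily
import Summits.Ventures.PercRepro.MSTightTighteningSplit

/-!
# The Ahlswede–Daykin two-family Marica–Schönheim theorem, and what it says at a tightening
# direction

Dossier proofs/MINE1-theoremS.md, Addendum 50 §2. **Theorem 37 of Ahlswede–Blinovsky, Lectures
on Advances in Combinatorics, Lecture 15 (Ahlswede–Daykin 1979)**: if every member of a family `S`
contains some member of a family `T`, then `|S \\ T| ≥ |S|` (`ahlswede_daykin_two_family`); by
complementation, if every member of `S` is contained in some member of `T`, then `|T \\ S| ≥ |S|`
(`ahlswede_daykin_two_family'`). Both are proved here from scratch by the ground-set induction of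
the cell's `MSTightTwoFamily` (the induction hypothesis on the projections and on the partner
family, the lifting inequalities `lift_diffs_left` / `lift_diffs_right`); Marica–Schönheim is the
case `T = S`.

At a tightening direction `r` of an excess-one family `F` (`|D(F)| = |F| + 1`, `proj r F` tight)
the differences `F₁ \\ K` and `K \\ F₀` lie in `X ∩ Y`, which has exactly `|K| + 1` elements
(`tight_proj_iff_card_edges`). Hence: **if every partnerless `r`-member contains a partner member
then there is at most one partnerless `r`-member** (`card_partr_sdiff_part0_le_one_of_forall_exists_subset`),
and **if every partnerless `r`-free member is contained in a partner member then there is at most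
one partnerless `r`-free member** (`card_part0_sdiff_partr_le_one_of_forall_exists_superset`). In
the open shape of Conjecture (T) (`|P₀|, |P₁| ≥ 2`) there are therefore a partnerless `r`-member
containing no partner member and a partnerless `r`-free member contained in no partner member
(`exists_partr_forall_partner_not_subset_of_two_le`,
`exists_part0_forall_not_subset_partner_of_two_le`).
-/

namespace PercRepro.MSTight

open Finset
open scoped FinsetFamily

variable {α : Type*} [DecidableEq α]

/-- The inductive statement of Theorem 37: for families whose members lie in `U`, if every member
of `S` contains a member of `T` then `|S| ≤ |S \\ T|`. -/
theorem ahlswede_daykin_two_family_aux (U : Finset α) :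
    ∀ (S T : Finset (Finset α)), (∀ s ∈ S, s ⊆ U) → (∀ s ∈ S, ∃ t ∈ T, t ⊆ s) →
      S.card ≤ (S \\ T).card := by
  induction U using Finset.induction_on with
  | empty =>
    intro S T hS hST
    rcases S.eq_empty_or_nonempty with rfl | hSne
    · simp
    · have hS1 : S = {∅} := by
        apply hSne.subset_singleton_iff.1
        intro s hs
        rw [Finset.mem_singleton]
        exact Finset.subset_empty.1 (hS s hs)
      have hcard : S.card = 1 := by rw [hS1]; simp
      obtain ⟨s, hs⟩ := id hSne
      obtain ⟨t, ht, -⟩ := hST s hs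
      have : 0 < (S \\ T).card := Finset.card_pos.2 (hSne.diffs ⟨t, ht⟩)
      omega
  | insert r U' hr ih =>
    intro S T hS hST
    -- the induction hypothesis on the projections
    have ih1 : (proj r S).card ≤ (proj r S \\ proj r T).card := by
      apply ih (proj r S) (proj r T) (proj_subset_of_subset_insert hr hS)
      intro s' hs'
      obtain ⟨s, hs, rfl⟩ := mem_proj.1 hs'
      obtain ⟨t, ht, hts⟩ := hST s hs
      exact ⟨t.erase r, mem_proj.2 ⟨t, ht, rfl⟩, Finset.erase_subset_erase r hts⟩
    -- the induction hypothesis on the partner family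
    have ih2 : (partner r S).card ≤ (partner r S \\ part0 r T).card := by
      apply ih (partner r S) (part0 r T) (partner_subset_of_subset_insert hS)
      intro k hk
      have hk0 := mem_part0.1 (Finset.mem_inter.1 hk).1
      obtain ⟨t, ht, htk⟩ := hST k hk0.1
      exact ⟨t, mem_part0.2 ⟨ht, fun hrt => hk0.2 (htk hrt)⟩, htk⟩
    have l1 := lift_diffs_left r T S
    have hcard := card_eq_card_proj_add_card_partner r S
    omega

/-- **Theorem 37 (Ahlswede–Daykin 1979).** If every member of `S` contains some member of `T`,
then `|S \\ T| ≥ |S|`. -/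
theorem ahlswede_daykin_two_family (S T : Finset (Finset α)) (hST : ∀ s ∈ S, ∃ t ∈ T, t ⊆ s) :
    S.card ≤ (S \\ T).card :=
  ahlswede_daykin_two_family_aux (S.biUnion id) S T
    (fun _ hs => Finset.subset_biUnion_of_mem id hs) hST

/-- The inductive statement of the mirror: if every member of `S` is contained in a member of `T`
then `|S| ≤ |T \\ S|`. -/
theorem ahlswede_daykin_two_family_aux' (U : Finset α) :
    ∀ (S T : Finset (Finset α)), (∀ s ∈ S, s ⊆ U) → (∀ s ∈ S, ∃ t ∈ T, s ⊆ t) →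
      S.card ≤ (T \\ S).card := by
  induction U using Finset.induction_on with
  | empty =>
    intro S T hS hST
    rcases S.eq_empty_or_nonempty with rfl | hSne
    · simp
    · have hS1 : S = {∅} := by
        apply hSne.subset_singleton_iff.1
        intro s hs
        rw [Finset.mem_singleton]
        exact Finset.subset_empty.1 (hS s hs)
      have hcard : S.card = 1 := by rw [hS1]; simp
      obtain ⟨s, hs⟩ := id hSne
      obtain ⟨t, ht, -⟩ := hST s hs
      have : 0 < (T \\ S).card := Finset.card_pos.2 (Finset.Nonempty.diffs ⟨t, ht⟩ hSne)
      omega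
  | insert r U' hr ih =>
    intro S T hS hST
    -- the induction hypothesis on the projections
    have ih1 : (proj r S).card ≤ (proj r T \\ proj r S).card := by
      apply ih (proj r S) (proj r T) (proj_subset_of_subset_insert hr hS)
      intro s' hs'
      obtain ⟨s, hs, rfl⟩ := mem_proj.1 hs'
      obtain ⟨t, ht, hst⟩ := hST s hs
      exact ⟨t.erase r, mem_proj.2 ⟨t, ht, rfl⟩, Finset.erase_subset_erase r hst⟩
    -- the induction hypothesis on the partner family
    have ih2 : (partner r S).card ≤ (partr r T \\ partner r S).card := by
      apply ih (partner r S) (partr r T) (partner_subset_of_subset_insert hS)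
      intro k hk
      have hk1 := mem_partr.1 (Finset.mem_inter.1 hk).2
      obtain ⟨t, ht, hkt⟩ := hST (insert r k) hk1.2
      refine ⟨t.erase r, mem_partr.2 ⟨Finset.notMem_erase r t, ?_⟩, ?_⟩
      · rw [Finset.insert_erase (hkt (Finset.mem_insert_self r k))]
        exact ht
      · intro x hx
        exact Finset.mem_erase.2 ⟨fun h => hk1.1 (h ▸ hx), hkt (Finset.mem_insert_of_mem hx)⟩
    have l2 := lift_diffs_right r T S
    have hcard := card_eq_card_proj_add_card_partner r S
    omega

/-- **The mirror of Theorem 37.** If every member of `S` is contained in some member of `T`, then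
`|T \\ S| ≥ |S|`. -/
theorem ahlswede_daykin_two_family' (S T : Finset (Finset α)) (hST : ∀ s ∈ S, ∃ t ∈ T, s ⊆ t) :
    S.card ≤ (T \\ S).card :=
  ahlswede_daykin_two_family_aux' (S.biUnion id) S T
    (fun _ hs => Finset.subset_biUnion_of_mem id hs) hST

section Tightening

variable {r : α} {F : Finset (Finset α)}
variable (hF : (F \\ F).card = F.card + 1) (hP : Tight (proj r F))
include hF hP

/-- **At a tightening direction of an excess-one family, if every partnerless `r`-member contains a
partner member then `|F₁| ≤ |K| + 1`.** -/
theorem card_partr_le_succ_of_forall_exists_subset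
    (h : ∀ t ∈ partr r F, t ∉ part0 r F → ∃ k ∈ partner r F, k ⊆ t) :
    (partr r F).card ≤ (partner r F).card + 1 := by
  have h37 : (partr r F).card ≤ (partr r F \\ partner r F).card := by
    apply ahlswede_daykin_two_family
    intro t ht
    by_cases ht0 : t ∈ part0 r F
    · exact ⟨t, Finset.mem_inter.2 ⟨ht0, ht⟩, Finset.Subset.refl t⟩
    · exact h t ht ht0
  have hsub := Finset.card_le_card (partr_diffs_partner_subset (r := r) (F := F))
  have hXY := (tight_proj_iff_card_edges hF r).1 hP
  omega

/-- **The mirror: if every partnerless `r`-free member is contained in a partner member then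
`|F₀| ≤ |K| + 1`.** -/
theorem card_part0_le_succ_of_forall_exists_superset
    (h : ∀ s ∈ part0 r F, s ∉ partr r F → ∃ k ∈ partner r F, s ⊆ k) :
    (part0 r F).card ≤ (partner r F).card + 1 := by
  have h37 : (part0 r F).card ≤ (partner r F \\ part0 r F).card := by
    apply ahlswede_daykin_two_family'
    intro s hs
    by_cases hs1 : s ∈ partr r F
    · exact ⟨s, Finset.mem_inter.2 ⟨hs, hs1⟩, Finset.Subset.refl s⟩
    · exact h s hs hs1
  have hsub := Finset.card_le_card (partner_diffs_part0_subset (r := r) (F := F))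
  have hXY := (tight_proj_iff_card_edges hF r).1 hP
  omega

/-- If every partnerless `r`-member contains a partner member, there is at most one partnerless
`r`-member. -/
theorem card_partr_sdiff_part0_le_one_of_forall_exists_subset
    (h : ∀ t ∈ partr r F, t ∉ part0 r F → ∃ k ∈ partner r F, k ⊆ t) :
    (partr r F \ part0 r F).card ≤ 1 := by
  have h1 := card_partr_le_succ_of_forall_exists_subset hF hP h
  have h3 : (partr r F \ part0 r F).card + (partner r F).card = (partr r F).card := by
    rw [partner, inter_comm, card_sdiff_add_card_inter]
  omega

/-- If every partnerless `r`-free member is contained in a partner member, there is at most one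
partnerless `r`-free member. -/
theorem card_part0_sdiff_partr_le_one_of_forall_exists_superset
    (h : ∀ s ∈ part0 r F, s ∉ partr r F → ∃ k ∈ partner r F, s ⊆ k) :
    (part0 r F \ partr r F).card ≤ 1 := by
  have h1 := card_part0_le_succ_of_forall_exists_superset hF hP h
  have h3 : (part0 r F \ partr r F).card + (partner r F).card = (part0 r F).card := by
    rw [partner, card_sdiff_add_card_inter]
  omega

/-- **In the open shape some partnerless `r`-member contains no partner member.** -/
theorem exists_partr_forall_partner_not_subset_of_two_le
    (h2 : 2 ≤ (partr r F \ part0 r F).card) :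
    ∃ t ∈ partr r F, t ∉ part0 r F ∧ ∀ k ∈ partner r F, ¬ k ⊆ t := by
  by_contra hcon
  have h : ∀ t ∈ partr r F, t ∉ part0 r F → ∃ k ∈ partner r F, k ⊆ t := by
    intro t ht ht0
    by_contra hne
    exact hcon ⟨t, ht, ht0, fun k hk hkt => hne ⟨k, hk, hkt⟩⟩
  have := card_partr_sdiff_part0_le_one_of_forall_exists_subset hF hP h
  omega

/-- **In the open shape some partnerless `r`-free member is contained in no partner member.** -/
theorem exists_part0_forall_not_subset_partner_of_two_le
    (h2 : 2 ≤ (part0 r F \ partr r F).card) :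
    ∃ s ∈ part0 r F, s ∉ partr r F ∧ ∀ k ∈ partner r F, ¬ s ⊆ k := by
  by_contra hcon
  have h : ∀ s ∈ part0 r F, s ∉ partr r F → ∃ k ∈ partner r F, s ⊆ k := by
    intro s hs hs1
    by_contra hne
    exact hcon ⟨s, hs, hs1, fun k hk hsk => hne ⟨k, hk, hsk⟩⟩
  have := card_part0_sdiff_partr_le_one_of_forall_exists_superset hF hP h
  omega

end Tightening

end PercRepro.MSTight
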